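import Literature.Computability.Complexity.BoundedQuantifiersFine
import Literature.Computability.Complexity.ExpClosure
import Literature.Computability.Complexity.IKWExtTable
import HarnessLib

/-!
# Truth tables at polynomial overhead: a `2^{O(m)} · poly(N) · T(m)` machine writing `tt(f₀ ∩ {0,1}^m)`
# (the table arming the i.o. generator of Babai–Fortnow–Nisan–Wigderson; IW98, Case 1)

Literature / complexity toolkit (machine level, TM2 model), companion of
`BoundedQuantifiersFine.lean`. Second machine step of hypothesis `h₁` (Case 1 of
Impagliazzo–Wigderson 1998 = Babai–Fortnow–Nisan–Wigderson 1993) of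
`impagliazzoWigderson1998_of_generators` (`UniformDerandomizationAssembly.lean`): the generator of
IKW's Theorem 11 (`IKW2002_thm11_tableGenerator`, `IKWGeneratorsProofs.lean`) reads the TRUTH TABLE
of the hard function, which under `EXP ⊄ P/poly` is a slice `f₀ ∩ {0,1}^m` of a language
`f₀ ∈ EXP`, `m = m(n)` a small scale of the instance length; the simulating machine must write
this table itself, by `2^m` runs of the exponential-time decider of `f₀` — in time
`2^{O(m)} · poly(n) · 2^{q₀(m)}`, exponential in the SCALE only.

* `NKannan.exists_table_fine` — the generic tabulator: for an `FP` producer of the range `β` and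
  a language `A` decided one level up within `t n N'` steps, a machine writing on `w` (core
  `x = fstP^[k] w` of length `n`, `b = β n`) the `2^b` verdict bits
  `[⟨w, natBits b j⟩ ∈ A]`, `j < 2^b`, within `fineCost a p β t n |w|` steps (the fine lister of
  `exists_lister_fine` feeding the decider through `flatMapMachine`; this is the proof of
  `DecIn.bmajFine` without its last stage);
* `NKannan.decIn_takeSnd_preimage` — the rows: `{v | (sndP v) ↾ β|fstP^[k+1] v| ∈ f₀}` is decided
  within `poly(N') + 2^{q₀(β n)}` steps when `f₀` is decided in time `2^{q₀}` (the truncation keeps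
  the cost independent of the word length);
* `NKannan.ofFn_boolFunEquivFin_symm`, `NKannan.truthTable_sliceFn_eq_map_range` — the verdict
  bits `[natBits m j ∈ f₀]`, `j < 2^m`, ARE the truth table of `f₀.sliceFn m`
  (`MetaComplexity.truthTable`, little-endian enumeration `boolFunEquivFin`, `IKWGenM.bitsToNat_ofFn`);
* **`NKannan.exists_truthTable_machine`** — for `f₀` decided in time `2^{q₀(n)}` and an `FP`-produced
  scale `β`, a machine writing `truthTable (f₀.sliceFn (β |x|))` on `x` within
  `fineCost a p β (fun n N' => c N'^d + c + 2^{q₀(β n)}) |x| |x|` steps.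

Everything is proved; no definitions.

## References

* L. Babai, L. Fortnow, N. Nisan, A. Wigderson, *BPP has subexponential time simulations unless
  EXPTIME has publishable proofs*, Comput. Complexity 3 (1993) 307–318, §4 (the generator is run on
  the truth table of an `EXP`-complete function at a small input length; cited through
  [ImpagliazzoWigderson2001], §2.1, first paragraph).
* [AroraBarakCC2009] S. Arora, B. Barak, *Computational Complexity: A Modern Approach*, CUP 2009,
  proof of Lemma 20.3 / Thm. 20.6 ("compute the truth table of `f` on inputs of length `m` in time
  `2^{O(m)}`"), §1.3–1.4 (machine constructions).
-/

noncomputable section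

namespace Literature.Computability.Complexity

namespace NKannan

open _root_.Computability Turing Function Polynomial MetaComplexity Plumb

/-! ### The generic tabulator -/

/-- **Tables at polynomial overhead.** If `A` is decided within `t n N'` steps one level up and
`0^{β n}` is producible in `FP`, some machine writes on every word `w` (core `x = fstP^[k] w` of
length `n`, `b = β n`) the list of the `2^b` verdict bits `[⟨w, natBits b j⟩ ∈ A]`, `j < 2^b`, within
`fineCost a p β t n |w| = 2^{a (b + 1)} · p(|w|) · (t n (2|w| + 2 + b) + 1)` steps: the fine lister,
then the decider of `A` on each entry with the verdict bits concatenated (`flatMap_outputsWithin`).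
[cite: AroraBarakCC2009, §7.1 (remark after Def. 7.3) and §1.3–1.4] -/
theorem exists_table_fine (k : ℕ) {β : ℕ → ℕ} (hβ : FPProducer β) {A : Language Bool} {t : ℕ → ℕ → ℕ}
    (hA : DecIn (k + 1) A t) :
    ∃ (a : ℕ) (p : Polynomial ℕ) (M : TM2ComputableAux Bool Bool), ∀ w : List Bool,
      M.OutputsWithin w
        ((List.range (2 ^ β (fstP^[k] w).length)).map fun j =>
          A.boolIndicator (boolPair w (natBits (β (fstP^[k] w).length) j)))
        (fineCost a p β t (fstP^[k] w).length w.length) := by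
  classical
  obtain ⟨T₁, M₁, hT₁, hM₁⟩ := exists_lister_fine k hβ
  obtain ⟨MA, hMA⟩ := hA
  obtain ⟨Ms, hMs⟩ := stripT.exists_outputsWithin
  let M₂ : TM2ComputableAux (Option Bool) Bool := Ms.comp MA
  let b : List Bool → ℕ := fun w => β (fstP^[k] w).length
  let L : List Bool → ℕ := fun w => 2 * w.length + 2 + b w
  let R : List Bool → ℕ := fun w => 2 ^ b w
  let Q : List Bool → ℕ := fun w =>
    T₁ w + R w * (((stripT.maxEmit + 1) * L w + 3) + 2 * L w + 2 + 3) + 3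
  have hQ : PBnd b (fun w => w.length) Q := by
    have bc : ∀ K, PBnd b (fun w : List Bool => w.length) fun _ => K := fun K => PBnd.const K
    have bN : PBnd b (fun w : List Bool => w.length) fun w => w.length := PBnd.self_N
    have bb : PBnd b (fun w : List Bool => w.length) b := PBnd.self_b
    have bL : PBnd b (fun w : List Bool => w.length) L := (((bc 2).mul bN).add (bc 2)).add bb
    have bR : PBnd b (fun w : List Bool => w.length) R := PBnd.two_pow 1 fun w => by simp only [b]; omega
    refine (hT₁.add (bR.mul ?_)).add (bc 3)
    exact (((((bc _).mul bL).add (bc 3)).add ((bc 2).mul bL)).add (bc 2)).add (bc 3)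
  obtain ⟨a, p, hap⟩ := hQ
  refine ⟨a + 1, p + 1, M₁.flatMapMachine M₂ none, fun w => ?_⟩
  set b₀ := β (fstP^[k] w).length with hb₀
  let q : ℕ → Bool := fun j => Set.boolIndicator A (boolPair w (natBits b₀ j))
  have hw : ∀ j : ℕ, (none : Option Bool) ∉ (boolPair w (natBits b₀ j)).map some := by simp
  have h₂ : ∀ j : ℕ, M₂.OutputsWithin ((boolPair w (natBits b₀ j)).map some) [q j]
      (t (fstP^[k] w).length (2 * w.length + 2 + b₀) +
        ((stripT.maxEmit + 1) * (2 * w.length + 2 + b₀) + 3)) := by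
    intro j
    have hs := hMs ((boolPair w (natBits b₀ j)).map some)
    rw [stripT_eval_map_some, List.length_map, length_boolPair, length_natBits] at hs
    have ha := hMA (boolPair w (natBits b₀ j))
    simp only [id_eq, iterate_fstP_boolPair, length_boolPair, length_natBits] at ha
    exact TM2ComputableAux.comp_outputsWithin _ _ hs ha
  have H₃ := TM2ComputableAux.flatMap_outputsWithin M₁ M₂ (sep := none) hw (hM₁ w) h₂
  rw [flatMap_singleton_eq_map] at H₃
  refine H₃.mono ?_
  have key := fine_arith (tA := t (fstP^[k] w).length (2 * w.length + 2 + b₀)) (hap w)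
  refine le_trans (le_of_eq ?_) (key.trans (le_of_eq ?_))
  · simp only [Q, L, R, b, List.length_map, length_boolPair, length_natBits, List.length_singleton,
      mul_one, List.map_const', List.length_range, List.sum_replicate, smul_eq_mul, ← hb₀]
    ring
  · simp only [fineCost, eval_add, eval_one, b, ← hb₀]

/-! ### The rows: the truncated second component -/

/-- **Deciding the rows.** For an `FP` producer `Z` of `β` and `f₀` decided within `2^{q₀(n)}` steps,
the language `{v | (sndP v) ↾ β|fstP^[k+1] v| ∈ f₀}` is decided at level `k + 1` within
`c N'^d + c + 2^{q₀(β n)}` steps (compute the truncated row index in `FP`, then run the decider of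
`f₀` on a word of length `≤ β n`; the truncation makes the exponential part depend on the core only).
[cite: AroraBarakCC2009, §1.3 (composition) and Lemma 20.3 (proof)] -/
theorem decIn_takeSnd_preimage (k : ℕ) {β : ℕ → ℕ} (hβ : FPProducer β) {f₀ : Language Bool}
    {q₀ : Polynomial ℕ} (hf₀ : TimeDecidable (id : List Bool → List Bool) f₀ fun n => 2 ^ q₀.eval n) :
    ∃ c d : ℕ, DecIn (k + 1)
      ((fun v => (sndP v).take (β (fstP^[k + 1] v).length)) ⁻¹' f₀)
      fun n N => c * N ^ d + c + 2 ^ q₀.eval (β n) := by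
  obtain ⟨Z, hZ, hZv⟩ := hβ
  have hG : (takeFn ∘ fanoutFn (Z ∘ fstP^[k + 1]) sndP) ∈ FP :=
    comp_mem_FP takeFn_mem_FP
      (fanoutFn_mem_FP (comp_mem_FP hZ (iterate_fstP_mem_FP (k + 1))) sndP_mem_FP)
  have hGv : ∀ v, (takeFn ∘ fanoutFn (Z ∘ fstP^[k + 1]) sndP) v =
      (sndP v).take (β (fstP^[k + 1] v).length) := fun v => by
    simp only [comp_apply, fanoutFn_apply, takeFn_boolPair, hZv, List.length_replicate]
  obtain ⟨pG, MG, hMG⟩ := exists_outputsWithin_of_mem_FP hG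
  obtain ⟨c, d, hcd⟩ := exists_eval_le_mul_pow_add pG
  obtain ⟨M₀, hM₀⟩ := hf₀
  refine ⟨c, d, MG.comp M₀, fun v => ?_⟩
  have h1 := hMG v
  rw [hGv] at h1
  set u := (sndP v).take (β (fstP^[k + 1] v).length) with hu
  have hlen : u.length ≤ β (fstP^[k + 1] v).length := by
    rw [hu, List.length_take]; exact min_le_left _ _
  have h2 : M₀.OutputsWithin u (encodeBool (f₀.boolIndicator u)) (2 ^ q₀.eval (β (fstP^[k + 1] v).length)) :=
    (hM₀ u).mono (Nat.pow_le_pow_right (by norm_num) (TM2Iter.eval_mono q₀ hlen))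
  exact (TM2ComputableAux.comp_outputsWithin _ _ h1 h2).mono
    (by linarith [hcd v.length])

/-! ### The verdict bits are the truth table -/

/-- **The `i`-th assignment of the cube, listed, is the numeral `natBits m i`.** [folklore] -/
theorem ofFn_boolFunEquivFin_symm (m : ℕ) (i : Fin (2 ^ m)) :
    List.ofFn ((boolFunEquivFin m).symm i) = natBits m i := by
  have h := CoinEnum.eq_natBits_of_length (List.length_ofFn (f := (boolFunEquivFin m).symm i))
  rwa [IKWGenM.bitsToNat_ofFn, Equiv.apply_symm_apply] at h

/-- **The verdict bits are the truth table**: `tt(f₀.sliceFn m) = [[natBits m j ∈ f₀]]_{j < 2^m}`.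
[folklore] -/
theorem truthTable_sliceFn_eq_map_range (f₀ : Language Bool) (m : ℕ) :
    truthTable (f₀.sliceFn m) = (List.range (2 ^ m)).map fun j => f₀.boolIndicator (natBits m j) := by
  apply List.ext_getElem
  · simp
  · intro i h₁ h₂
    rw [length_truthTable] at h₁
    simp only [truthTable, Language.sliceFn, List.getElem_ofFn, List.getElem_map, List.getElem_range]
    rw [ofFn_boolFunEquivFin_symm m ⟨i, h₁⟩]

/-! ### The truth-table machine -/

/-- **The truth-table machine.** For `f₀` decided within `2^{q₀(n)}` steps and an `FP`-produced
scale `β`, some machine writes `truthTable (f₀.sliceFn (β |x|))` on every `x` within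
`fineCost a p β (fun n N' => c N'^d + c + 2^{q₀(β n)}) |x| |x|` steps — `2^{O(m)} · poly(|x|) · 2^{q₀(m)}`,
`m = β |x|`. [cite: AroraBarakCC2009, Lemma 20.3 / Thm. 20.6 (proof: the truth table in time `2^{O(m)}`)] -/
theorem exists_truthTable_machine {β : ℕ → ℕ} (hβ : FPProducer β) {f₀ : Language Bool}
    {q₀ : Polynomial ℕ} (hf₀ : TimeDecidable (id : List Bool → List Bool) f₀ fun n => 2 ^ q₀.eval n) :
    ∃ (a c d : ℕ) (p : Polynomial ℕ) (M : TM2ComputableAux Bool Bool), ∀ x : List Bool,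
      M.OutputsWithin x (truthTable (f₀.sliceFn (β x.length)))
        (fineCost a p β (fun n N' => c * N' ^ d + c + 2 ^ q₀.eval (β n)) x.length x.length) := by
  obtain ⟨c, d, hA⟩ := decIn_takeSnd_preimage 0 hβ hf₀
  obtain ⟨a, p, M, hM⟩ := exists_table_fine 0 hβ hA
  refine ⟨a, c, d, p, M, fun x => ?_⟩
  have h := hM x
  simp only [iterate_zero, id_eq] at h
  rw [truthTable_sliceFn_eq_map_range]
  convert h using 3 with j
  show f₀.boolIndicator (natBits (β x.length) j) =
    f₀.boolIndicator ((sndP (boolPair x (natBits (β x.length) j))).take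
      (β (fstP^[0 + 1] (boolPair x (natBits (β x.length) j))).length))
  rw [sndP_boolPair, iterate_fstP_boolPair, iterate_zero, id_eq,
    List.take_of_length_le (by rw [length_natBits])]

end NKannan

end Literature.Computability.Complexity

end
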